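import Summits.QuantumFields.YangMills.Theorems.BalabanUVNodesN15CurvedGluingCubeDressedGeneralRightEntries
import Summits.QuantumFields.YangMills.Theorems.BalabanUVNodesN15TwoSpacingGluingAdjointDefectGluing
import HarnessLib

/-!
# THE ADJOINT (LEFT-RESOLVENT) FORM OF THE GENERAL DRESSED CUBE: `pr₀X̂ = (1 − 𝒲)⁻¹G₀`, `𝒲 = G₀∘V̂∘jet∘M_χ` — its RIGHT entries `X∘Q = Ñ_𝒲∘(G₀∘Q)` from the flat cube's right entries ONLY
# (no mixed `∇N∇` rows), its RIGHT locality with defect `X∘Δ∘M_h = M_h + Ñ_𝒲∘F + X∘V_m`, and their two-spacing η-defects (dag-n15-c g18, FILE 148; N15 = NE2, s1)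

Cell `pub-ymgap`, seat `pub-ymgap-dag-n15-c` (R134 (a); HUMAN RULING D-0062), generation 18.  `bears_on: R4∕N15 · K3⁸ SpineGivenEndpointR13SepCoPHV (stmt-QuantumFields-27366)`.
Filed `--kind proof --supports stmt-QuantumFields-27366 --as helper` — COUNT-NEUTRAL.  Theorems only; 0 `def`, 0 `sorry`.  Imports BY NAME dag-n15-w3 file 29 `…CurvedGluingCubeDressedGeneralRightEntries`
(`projO_dressedV_comp_cutoffs`, `hasMaj_idef_projO_dressedV_comp_loc₂_of`; through it file 23 `stack_eq_jet_comp`, `projO_none_dressedV`, `V_comp_dressedV`, file 24 `mulOp_eq_zero_of_vanish`,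
dag-n15-c B1a∕B2 `bgPropV`, `bgPropV_fix_right`?—no: `bgPropV_fix`, `stack`, `projO`, `projO_none_comp_stack`) and FILE 147 `…TwoSpacingGluingAdjointDefectGluing` (`hasMaj_neumannR_comp`; through it
FILES 43∕44 `neumannR`, `neumannR_fix`, `neumannR_fix_right`, `neumannR_comp_one_sub`, `isUnit_neumannR`, `glueInvL`, `hasMaj_idef_glueInvL_comp`, FILE 47 `hasMaj_localize`).  Nothing in the
tree is modified; nothing of dag-n15-w3's restated.

WHY (the located obstruction, numbers not adjectives).  Entry 2 of (3.42) is the RIGHT-composed `G∇*_U`; FILE 147 glues it on the adjoint side from the cubes' right entries `G_□∘E`.  For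
dag-n15-w3's dressed cube `X̂ = (1 − ŜV̂)⁻¹Ŝ` (`Ŝ = (G₀, (D_j)_j)`, `D_j = Dq_j∘G₀`) the jet-form right entries (file 29 `hasMaj_dressedV_comp_fgrad_loc₂`, dag-n15-w5
`hasMaj_dressedV_comp_commOp_cubeOp_out`, file 41) display the MIXED second-order sup rows `hDQ : D_j∘∇^±_μ ≤ β₂e^{−δd}` of the flat cube.  On the cover at spacing `L^{−k}` such a row over a
unit block is a sum of the order-zero singular kernel `≈ |x − x′|^{−4}` (d + 1 = 4), i.e. `≳ C·k·log L`: NOT uniform in the family index — the reason [B9] prints (3.44)–(3.45) in Hölder norms.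
The VALUE component needs no mixed row: by file 23 `X̂ = jet∘X` (`dressedV_eq_jet_comp`), `X = G₀ + G₀V̂X̂ = G₀ + (G₀∘V̂∘jet)∘X`, and with the flat cube's output cut-off `M_χG₀ = G₀` also
`X = G₀ + 𝒲∘X` for `𝒲 := G₀∘V̂∘jet∘M_χ` — the jet's derivatives now fall INSIDE the cube between `V̂` and `M_χ`, where at the cover they meet the smooth output of `G₀ = M_χ̃N_□` only.  Hence
`X = (1 − 𝒲)⁻¹G₀ = glueInvL 𝒲 G₀` (FILE 44's adjoint arrangement at the CUBE level) and `X∘Q = Ñ_𝒲∘(G₀∘Q)`: the dressed cube's right entries from the flat right entries `G₀∘Q` and the rows of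
`𝒲` (first-order right entries `N_□∘∇^±` sandwiched, coefficient letters) — all η-uniform at the cover.

WHAT.  §1 algebra (any perturbation `V̂` of the jet): ★ `projO_dressedV_fix_left` (`X = G₀ + (G₀V̂jet)X`), `mulOp_comp_projO_dressedV` (`M_χX = X`), ★ `projO_dressedV_fix_left_cut`
(`X = G₀ + 𝒲X`), ★★ `projO_dressedV_eq_glueInvL` (`X = glueInvL 𝒲 G₀`, given the unit of `1 − [𝒲]`), `projO_dressedV_comp_eq` (`X∘Q = Ñ_𝒲∘(G₀∘Q)`), ★ `projO_dressedV_fix_right`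
(`X = G₀ + X∘V̂∘Ŝ`), ★★ `projO_dressedV_comp_lap_mulOp` — RIGHT LOCALITY WITH DEFECT: `Δ = Δ₀ − V_t`, flat right locality `G₀Δ₀M_h = M_h + F`, the cube's perturbation read on `supp h`:
`V̂∘jet∘M_h = V_tM_h + V_m`, `M_χF = F` ⟹ `X∘Δ∘M_h = M_h + (Ñ_𝒲∘F + X∘V_m)` (FILE 147's `hloc` shape `G_□ΔM_{h_□} = M_{h_□} + Ẽ_□`).  §2 rows, one grid: ★★ `hasMaj_projO_dressedV_comp_adj`
(`X∘Q ≤ (1 − θ_𝒲c_r)⁻¹β₂c_r·e^{−(δ−2σ)d}` from `𝒲 ≤ θ_𝒲e^{−δd}`, `θ_𝒲c_r < 1`, `G₀∘Q ≤ β₂e^{−δd}` — NO `D_j∘Q` row), ★★ `hasMaj_projO_dressedV_comp_adj_loc₂` (two-sided localized by the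
cut-offs `χ`, `ψ ⊂ ψ₂`), ★ `hasMaj_neumannR_comp_loc₂` (the right-locality defect `Ñ_𝒲∘F ≤ 1_S1_S·(1 − θ_𝒲c_r)⁻¹ε_Fc_r·e^{−(δ−2σ)d}`).  §3 two grids: ★★★ `hasMaj_idef_projO_dressedV_comp_adj`
(`𝔇(X′Q′, XQ)` from `𝔇(𝒲′,𝒲) ≤ r`, `𝔇(G₀′Q′, G₀Q) ≤ m`: FILE 44 `hasMaj_idef_glueInvL_comp`), ★★ `hasMaj_idef_projO_dressedV_comp_adj_loc₂` (two-sided, file 29's localizer), ★★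
`hasMaj_idef_neumannR_comp_loc₂` (`𝔇(Ñ′F′, ÑF)`, two-sided).  CONSUMER: the cover — `𝒲`'s rows from dag-n15-a N-IIn's sandwiched right entries of the Neumann cube and the species letters,
then FILE 147 ⟹ `cvGlued∘D*` and the family's printed entry 2.

HONEST FRAMING ∕ LIMITS.  Finite-dimensional resolvent algebra + block-majorant bookkeeping over DISPLAYED data (the flat cube `G₀`, its right entries, the rows of `𝒲`, the flat right-locality
defect `F`, the mismatch `V_m`, cut-offs); proves NO estimate of any concrete propagator; nothing of [B6]∕[B9] asserted ((2.91)–(2.93) p.239, (2.133)–(2.136) p.247, (3.42) p.397, (3.62)–(3.65)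
pp.402–403, Thm 3.14 pp.426–427 = SHAPES ∕ MECHANISM ∕ TEMPLATE).  NE2⁺ NOT PRINTED, NOT proved; N15 NOT discharged; K3⁸ OPEN, skeleton v7 untouched (0∕2); counts of record UNMOVED (typed
28∕28 · discharged 6∕27 · A 6∕28); one finite 𝕋⁴ at fixed ε — NOT infinite volume, NOT OS on ℝ⁴, NOT a mass gap, NOT Clay; R4 closes the conditional finite-𝕋⁴ rung `BalabanLadder.UV` only.
Restate-immune (no Theses import).
-/

set_option autoImplicit false

noncomputable section

open scoped BigOperators

namespace Summit.QuantumFields.YangMills.BalabanUVNodes.N15.Gluing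

open Literature.MathematicalPhysics.QuantumFieldTheory.Balaban1983to89
open Literature.MathematicalPhysics.QuantumFieldTheory.Balaban1983to89.B11SectG (BlockNorm HasMaj RowSum hasMaj_comp_exp)
open Literature.MathematicalPhysics.QuantumFieldTheory.Balaban1983to89.B6RandomWalk (Triangle254)
open Literature.MathematicalPhysics.QuantumFieldTheory.Balaban1983to89.T4EtaRateDefect (idef idef_apply idef_comp)
open Literature.MathematicalPhysics.QuantumFieldTheory.Balaban1983to89.T4EtaRateCoeffDefect (pull pull_apply)
open Literature.MathematicalPhysics.QuantumFieldTheory.Balaban1983to89.B6Prop26Gluing (mulOp mulOp_apply ind ind_nonneg ind_le_one)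
open Summit.QuantumFields.YangMills.BalabanUVNodes.N15.MatrixSpecies (liftBlk liftMap)
open Summit.QuantumFields.YangMills.BalabanUVNodes.N15.BackgroundLayer (stack projO bgPropV bgPropV_fix projO_none_comp_stack mulVecLin_toMatrix' mulVecLin_toMatrix'_rect)
open Summit.QuantumFields.YangMills.BalabanUVNodes.N15.CurvedSpecies (stack_eq_jet_comp projO_none_dressedV V_comp_dressedV projO_dressedV_comp_cutoffs mulOp_eq_zero_of_vanish
  hasMaj_idef_projO_dressedV_comp_loc₂_of idef_out_in)

/-! ## §1 The adjoint form of the dressed cube: algebra -/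

section Algebra

variable {Y K : Type} [Fintype Y] [Fintype K] [DecidableEq Y] [DecidableEq K] {G₀ : (Y → ℝ) →ₗ[ℝ] (Y → ℝ)} {D Dq : K → (Y → ℝ) →ₗ[ℝ] (Y → ℝ)}
  {V : (Y × Option K → ℝ) →ₗ[ℝ] (Y → ℝ)}

/-- ★ **THE LEFT FIXED POINT ON FUNCTIONS**: `X = G₀ + (G₀∘V̂∘jet)∘X` (file 23: `X = G₀(1 + V̂X̂)`, `V̂X̂ = (V̂∘jet)X`). [cite: Balaban1985BackgroundPropagators, (3.64)–(3.65) pp.402–403 (shape)] -/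
theorem projO_dressedV_fix_left (hD : ∀ j, D j = Dq j ∘ₗ G₀) (hunit : IsUnit (1 - LinearMap.toMatrix' (stack G₀ D ∘ₗ V))) :
    projO none ∘ₗ bgPropV (stack G₀ D) V = G₀ + (G₀ ∘ₗ V ∘ₗ stack LinearMap.id Dq) ∘ₗ (projO none ∘ₗ bgPropV (stack G₀ D) V) := by
  have h := projO_none_dressedV (G₀ := G₀) (D := D) (V := V) hunit
  rw [V_comp_dressedV hD hunit] at h
  conv_lhs => rw [h]
  rw [LinearMap.comp_add, LinearMap.comp_id]
  simp only [LinearMap.comp_assoc]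

/-- The flat cube's OUTPUT cut-off passes to the dressed cube: `M_χG₀ = G₀` ⟹ `M_χX = X`. [cite: Balaban1984PropagatorsII, (2.133) p.247 (shape)] -/
theorem mulOp_comp_projO_dressedV (hunit : IsUnit (1 - LinearMap.toMatrix' (stack G₀ D ∘ₗ V))) {χ : Y → ℝ} (hGχ : mulOp χ ∘ₗ G₀ = G₀) :
    mulOp χ ∘ₗ (projO none ∘ₗ bgPropV (stack G₀ D) V) = projO none ∘ₗ bgPropV (stack G₀ D) V := by
  rw [projO_none_dressedV hunit, ← LinearMap.comp_assoc, hGχ]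

/-- ★ **THE LEFT FIXED POINT WITH THE CUT INSERTED**: `X = G₀ + 𝒲∘X`, `𝒲 = G₀∘V̂∘jet∘M_χ` — the jet's derivatives fall between `V̂` and `M_χ`, inside the cube.
[cite: Balaban1985BackgroundPropagators, (3.62)–(3.65) pp.402–403 (mechanism)] -/
theorem projO_dressedV_fix_left_cut (hD : ∀ j, D j = Dq j ∘ₗ G₀) (hunit : IsUnit (1 - LinearMap.toMatrix' (stack G₀ D ∘ₗ V))) {χ : Y → ℝ} (hGχ : mulOp χ ∘ₗ G₀ = G₀) :
    projO none ∘ₗ bgPropV (stack G₀ D) V = G₀ + (G₀ ∘ₗ V ∘ₗ stack LinearMap.id Dq ∘ₗ mulOp χ) ∘ₗ (projO none ∘ₗ bgPropV (stack G₀ D) V) := by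
  have hX := mulOp_comp_projO_dressedV (D := D) (V := V) hunit hGχ
  have hre : (G₀ ∘ₗ V ∘ₗ stack LinearMap.id Dq ∘ₗ mulOp χ) ∘ₗ (projO none ∘ₗ bgPropV (stack G₀ D) V) =
      (G₀ ∘ₗ V ∘ₗ stack LinearMap.id Dq) ∘ₗ (mulOp χ ∘ₗ (projO none ∘ₗ bgPropV (stack G₀ D) V)) := by
    simp only [LinearMap.comp_assoc]
  rw [hre, hX]
  exact projO_dressedV_fix_left hD hunit

/-- ★★ **THE ADJOINT FORM**: `X = (1 − 𝒲)⁻¹G₀ = glueInvL 𝒲 G₀` (FILE 44's adjoint arrangement at the cube level), given the unit of `1 − [𝒲]` (at the cover: from `𝒲`'s rows, FILE 43 `isUnit_neumannR`).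
[cite: Balaban1984PropagatorsII, (2.91)–(2.93) p.239 (both-sided expansions: shape); Balaban1985BackgroundPropagators, (3.64) p.403] -/
theorem projO_dressedV_eq_glueInvL (hD : ∀ j, D j = Dq j ∘ₗ G₀) (hunit : IsUnit (1 - LinearMap.toMatrix' (stack G₀ D ∘ₗ V))) {χ : Y → ℝ} (hGχ : mulOp χ ∘ₗ G₀ = G₀)
    (hunitW : IsUnit (1 - LinearMap.toMatrix' (G₀ ∘ₗ V ∘ₗ stack LinearMap.id Dq ∘ₗ mulOp χ))) :
    projO none ∘ₗ bgPropV (stack G₀ D) V = glueInvL (G₀ ∘ₗ V ∘ₗ stack LinearMap.id Dq ∘ₗ mulOp χ) G₀ := by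
  have h := projO_dressedV_fix_left_cut hD hunit hGχ
  have h1 : (LinearMap.id - G₀ ∘ₗ V ∘ₗ stack LinearMap.id Dq ∘ₗ mulOp χ) ∘ₗ (projO none ∘ₗ bgPropV (stack G₀ D) V) = G₀ := by
    rw [LinearMap.sub_comp, LinearMap.id_comp]
    exact sub_eq_of_eq_add h
  calc projO none ∘ₗ bgPropV (stack G₀ D) V
      = (neumannR (G₀ ∘ₗ V ∘ₗ stack LinearMap.id Dq ∘ₗ mulOp χ) ∘ₗ (LinearMap.id - G₀ ∘ₗ V ∘ₗ stack LinearMap.id Dq ∘ₗ mulOp χ)) ∘ₗ (projO none ∘ₗ bgPropV (stack G₀ D) V) := by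
        rw [neumannR_comp_one_sub hunitW, LinearMap.id_comp]
    _ = neumannR (G₀ ∘ₗ V ∘ₗ stack LinearMap.id Dq ∘ₗ mulOp χ) ∘ₗ G₀ := by rw [LinearMap.comp_assoc, h1]
    _ = glueInvL (G₀ ∘ₗ V ∘ₗ stack LinearMap.id Dq ∘ₗ mulOp χ) G₀ := rfl

/-- **RIGHT ENTRIES RIDE ALONG**: `X∘Q = Ñ_𝒲∘(G₀∘Q)` for every right factor `Q` (`Q = ∇^±_μ`, `∇*_U`). [cite: Balaban1985BackgroundPropagators, (3.42) p.397 (entry `G∇*_U`: shape)] -/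
theorem projO_dressedV_comp_eq (hD : ∀ j, D j = Dq j ∘ₗ G₀) (hunit : IsUnit (1 - LinearMap.toMatrix' (stack G₀ D ∘ₗ V))) {χ : Y → ℝ} (hGχ : mulOp χ ∘ₗ G₀ = G₀)
    (hunitW : IsUnit (1 - LinearMap.toMatrix' (G₀ ∘ₗ V ∘ₗ stack LinearMap.id Dq ∘ₗ mulOp χ))) (Q : (Y → ℝ) →ₗ[ℝ] (Y → ℝ)) :
    (projO none ∘ₗ bgPropV (stack G₀ D) V) ∘ₗ Q = neumannR (G₀ ∘ₗ V ∘ₗ stack LinearMap.id Dq ∘ₗ mulOp χ) ∘ₗ (G₀ ∘ₗ Q) := by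
  rw [projO_dressedV_eq_glueInvL hD hunit hGχ hunitW, glueInvL, LinearMap.comp_assoc]

/-- ★ **THE RIGHT FIXED POINT ON FUNCTIONS**: `X = G₀ + X∘V̂∘Ŝ` (n15-c `bgPropV_fix`'s cyclic twin, from the matrix identity `(1−T)⁻¹K = K + (1−T)⁻¹K[V̂][Ŝ]` — the derivation of n15-c g8
`bgPropV_fix_right` (`…FullPropagatorEntry2Defect`, off this file's import path), projected to the value component).
[cite: Balaban1985BackgroundPropagators, (3.65) p.403 («G′(U′U) = G′(U) + G′(U′U)V′(A)G′(U)»: shape)] -/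
theorem projO_dressedV_fix_right (hunit : IsUnit (1 - LinearMap.toMatrix' (stack G₀ D ∘ₗ V))) :
    projO none ∘ₗ bgPropV (stack G₀ D) V = G₀ + (projO none ∘ₗ bgPropV (stack G₀ D) V) ∘ₗ (V ∘ₗ stack G₀ D) := by
  set T := LinearMap.toMatrix' (stack G₀ D ∘ₗ V) with hT
  set Kx := LinearMap.toMatrix' (stack G₀ D) with hK
  have hdet := (Matrix.isUnit_iff_isUnit_det _).1 hunit
  have hTK : Kx * LinearMap.toMatrix' (V ∘ₗ stack G₀ D) = T * Kx := by
    rw [hT, hK, LinearMap.toMatrix'_comp, LinearMap.toMatrix'_comp, Matrix.mul_assoc]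
  have h1 : (1 - T)⁻¹ * ((1 - T) * Kx) = Kx := by
    rw [← Matrix.mul_assoc, Matrix.nonsing_inv_mul _ hdet, Matrix.one_mul]
  rw [Matrix.sub_mul, Matrix.one_mul, Matrix.mul_sub, sub_eq_iff_eq_add] at h1
  have h : (1 - T)⁻¹ * Kx = Kx + (1 - T)⁻¹ * Kx * LinearMap.toMatrix' (V ∘ₗ stack G₀ D) := by
    rw [Matrix.mul_assoc, hTK, ← Matrix.mul_assoc]
    conv_lhs => rw [h1]
    rw [Matrix.mul_assoc]
  have hX : bgPropV (stack G₀ D) V = stack G₀ D + bgPropV (stack G₀ D) V ∘ₗ (V ∘ₗ stack G₀ D) := by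
    unfold bgPropV
    rw [← hT, ← hK]
    conv_lhs => rw [h]
    rw [Matrix.mulVecLin_add, Matrix.mulVecLin_mul, hK, mulVecLin_toMatrix'_rect, mulVecLin_toMatrix']
  conv_lhs => rw [hX]
  rw [LinearMap.comp_add, projO_none_comp_stack, LinearMap.comp_assoc]

/-- ★★ **RIGHT LOCALITY WITH DEFECT** — FILE 147's `hloc` shape `G_□∘Δ∘M_{h_□} = M_{h_□} + Ẽ_□` for the dressed cube: with `Δ = Δ₀ − V_t`, the flat cube's right locality `G₀∘Δ₀∘M_h = M_h + F`
(`M_χF = F`), and the cube's perturbation read on `supp h`, `V̂∘jet∘M_h = V_t∘M_h + V_m`:  `X∘Δ∘M_h = M_h + (Ñ_𝒲∘F + X∘V_m)`  (`(1 + Ñ_𝒲𝒲)F = Ñ_𝒲F` by the right fixed point of `Ñ`).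
[cite: Balaban1984PropagatorsII, (2.91)–(2.92) p.239 (mechanism, transposed); Balaban1985BackgroundPropagators, (3.62)–(3.65) pp.402–403, (3.76) p.405 (shapes)] -/
theorem projO_dressedV_comp_lap_mulOp (hD : ∀ j, D j = Dq j ∘ₗ G₀) (hunit : IsUnit (1 - LinearMap.toMatrix' (stack G₀ D ∘ₗ V))) {χ : Y → ℝ} (hGχ : mulOp χ ∘ₗ G₀ = G₀)
    (hunitW : IsUnit (1 - LinearMap.toMatrix' (G₀ ∘ₗ V ∘ₗ stack LinearMap.id Dq ∘ₗ mulOp χ))) {Δ Δ₀ Vt Vm F : (Y → ℝ) →ₗ[ℝ] (Y → ℝ)} {h : Y → ℝ} (hA : Δ = Δ₀ - Vt)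
    (hflat : G₀ ∘ₗ Δ₀ ∘ₗ mulOp h = mulOp h + F) (hVt : (V ∘ₗ stack LinearMap.id Dq) ∘ₗ mulOp h = Vt ∘ₗ mulOp h + Vm) (hFχ : mulOp χ ∘ₗ F = F) :
    (projO none ∘ₗ bgPropV (stack G₀ D) V) ∘ₗ Δ ∘ₗ mulOp h =
      mulOp h + (neumannR (G₀ ∘ₗ V ∘ₗ stack LinearMap.id Dq ∘ₗ mulOp χ) ∘ₗ F + (projO none ∘ₗ bgPropV (stack G₀ D) V) ∘ₗ Vm) := by
  have hfixR := projO_dressedV_fix_right (G₀ := G₀) (D := D) (V := V) hunit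
  have hXL := projO_dressedV_eq_glueInvL hD hunit hGχ hunitW
  rw [glueInvL] at hXL
  -- the stack on `Δ₀M_h`: `V̂∘Ŝ∘Δ₀∘M_h = V̂∘jet∘(M_h + F)`
  have hS : (V ∘ₗ stack G₀ D) ∘ₗ Δ₀ ∘ₗ mulOp h = (V ∘ₗ stack LinearMap.id Dq) ∘ₗ (mulOp h + F) := by
    rw [stack_eq_jet_comp hD]
    simp only [LinearMap.comp_assoc]
    rw [hflat]
  -- `X∘Δ₀∘M_h = M_h + F + X(V_tM_h + V_m) + X∘V̂∘jet∘F`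
  have h2 : (projO none ∘ₗ bgPropV (stack G₀ D) V) ∘ₗ Δ₀ ∘ₗ mulOp h =
      mulOp h + F + (projO none ∘ₗ bgPropV (stack G₀ D) V) ∘ₗ (Vt ∘ₗ mulOp h + Vm) + (projO none ∘ₗ bgPropV (stack G₀ D) V) ∘ₗ ((V ∘ₗ stack LinearMap.id Dq) ∘ₗ F) := by
    conv_lhs => rw [hfixR]
    rw [LinearMap.add_comp, hflat]
    have hre : ((projO none ∘ₗ bgPropV (stack G₀ D) V) ∘ₗ (V ∘ₗ stack G₀ D)) ∘ₗ Δ₀ ∘ₗ mulOp h =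
        (projO none ∘ₗ bgPropV (stack G₀ D) V) ∘ₗ ((V ∘ₗ stack G₀ D) ∘ₗ Δ₀ ∘ₗ mulOp h) := by
      simp only [LinearMap.comp_assoc]
    rw [hre, hS, LinearMap.comp_add, hVt, LinearMap.comp_add]
    abel
  -- `X∘V̂∘jet∘F = Ñ∘𝒲∘F`
  have h4 : (projO none ∘ₗ bgPropV (stack G₀ D) V) ∘ₗ ((V ∘ₗ stack LinearMap.id Dq) ∘ₗ F) =
      neumannR (G₀ ∘ₗ V ∘ₗ stack LinearMap.id Dq ∘ₗ mulOp χ) ∘ₗ ((G₀ ∘ₗ V ∘ₗ stack LinearMap.id Dq ∘ₗ mulOp χ) ∘ₗ F) := by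
    conv_lhs => rw [← hFχ, hXL]
    simp only [LinearMap.comp_assoc]
  -- `F + Ñ𝒲F = ÑF`
  have h5 : F + neumannR (G₀ ∘ₗ V ∘ₗ stack LinearMap.id Dq ∘ₗ mulOp χ) ∘ₗ ((G₀ ∘ₗ V ∘ₗ stack LinearMap.id Dq ∘ₗ mulOp χ) ∘ₗ F) =
      neumannR (G₀ ∘ₗ V ∘ₗ stack LinearMap.id Dq ∘ₗ mulOp χ) ∘ₗ F := by
    conv_rhs => rw [neumannR_fix_right hunitW]
    rw [LinearMap.add_comp, LinearMap.id_comp]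
    simp only [LinearMap.comp_assoc]
  -- assemble
  have h1 : (projO none ∘ₗ bgPropV (stack G₀ D) V) ∘ₗ Δ ∘ₗ mulOp h =
      (projO none ∘ₗ bgPropV (stack G₀ D) V) ∘ₗ Δ₀ ∘ₗ mulOp h - (projO none ∘ₗ bgPropV (stack G₀ D) V) ∘ₗ (Vt ∘ₗ mulOp h) := by
    rw [hA, LinearMap.sub_comp, LinearMap.comp_sub]
  rw [h1, h2, h4, LinearMap.comp_add, ← h5]
  abel

end Algebra

/-! ## §2 Rows, one grid: the right entries from the flat right entries and `𝒲`'s rows; the right-locality defect -/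

section Rows

variable {X ι J : Type} [Fintype X] [DecidableEq X] [Fintype ι] [DecidableEq ι] [Fintype J] [DecidableEq J] {g : B6.Geometry} (blk : X → g.Site) {σ cr : ℝ}
  {G₀ : (X × ι → ℝ) →ₗ[ℝ] (X × ι → ℝ)} {D Dq : J ⊕ J → (X × ι → ℝ) →ₗ[ℝ] (X × ι → ℝ)} {V : ((X × ι) × Option (J ⊕ J) → ℝ) →ₗ[ℝ] (X × ι → ℝ)}

/-- ★★ **A RIGHT ENTRY OF THE DRESSED CUBE IN THE ADJOINT FORM, ONE GRID**: `𝒲 ≤ θ_𝒲e^{−δd}` with `θ_𝒲c_r < 1`, the flat right entry `G₀∘Q ≤ β₂e^{−δd}`, `2σ ≤ δ` ⟹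
`X∘Q ≤ (1 − θ_𝒲c_r)⁻¹β₂c_r·e^{−(δ−2σ)d}` — NO mixed row `D_j∘Q`. [cite: Balaban1985BackgroundPropagators, (3.42) p.397 (entry `G∇*_U`: shape), (3.64)–(3.65) pp.402–403 (mechanism); Balaban1984PropagatorsII, (2.52)–(2.56) pp.232–233] -/
theorem hasMaj_projO_dressedV_comp_adj (htri : Triangle254 g) (hd : ∀ a b : g.Site, 0 ≤ g.dist a b) (hd0 : ∀ y : g.Site, g.dist y y = 0) (hrow : RowSum g σ cr) (hσ : 0 ≤ σ)
    (hD : ∀ j, D j = Dq j ∘ₗ G₀) (hunit : IsUnit (1 - LinearMap.toMatrix' (stack G₀ D ∘ₗ V))) {χX : X → ℝ} (hGχ : mulOp (fun p : X × ι => χX p.1) ∘ₗ G₀ = G₀)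
    {β₂ θW δ : ℝ} (hβ₂ : 0 ≤ β₂) (hθW : 0 ≤ θW) (hσδ : 2 * σ ≤ δ) (Q : (X × ι → ℝ) →ₗ[ℝ] (X × ι → ℝ))
    (hW : HasMaj (BlockNorm.ofBlocks g (liftBlk blk ι)) (BlockNorm.ofBlocks g (liftBlk blk ι)) (G₀ ∘ₗ V ∘ₗ stack LinearMap.id Dq ∘ₗ mulOp (fun p : X × ι => χX p.1))
      (fun y y' => θW * Real.exp (-(δ * g.dist y y'))))
    (hGQ : HasMaj (BlockNorm.ofBlocks g (liftBlk blk ι)) (BlockNorm.ofBlocks g (liftBlk blk ι)) (G₀ ∘ₗ Q) (fun y y' => β₂ * Real.exp (-(δ * g.dist y y')))) (hq : θW * cr < 1) :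
    HasMaj (BlockNorm.ofBlocks g (liftBlk blk ι)) (BlockNorm.ofBlocks g (liftBlk blk ι)) ((projO none ∘ₗ bgPropV (stack G₀ D) V) ∘ₗ Q)
      (fun y y' => (1 - θW * cr)⁻¹ * β₂ * cr * Real.exp (-((δ - 2 * σ) * g.dist y y'))) := by
  have hunitW := isUnit_neumannR (liftBlk blk ι) hd hrow hθW (by linarith) hW hq
  rw [projO_dressedV_comp_eq hD hunit hGχ hunitW Q]
  exact hasMaj_neumannR_comp (liftBlk blk ι) htri hd hd0 hrow hσ hβ₂ hθW hσδ hGQ hW hq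

/-- ★★ **… TWO-SIDED LOCALIZED** (FILE 147's `hGE` currency): in addition the cut-offs `supp χ` over `S`, `G₀ = G₀M_ψ` with the nested pair `M_ψ∘Q∘M_{ψ₂} = M_ψ∘Q`, `supp ψ₂` over `S` (file 29
`projO_dressedV_comp_cutoffs`) ⟹ `X∘Q ≤ 1_S(y)1_S(y′)·(1 − θ_𝒲c_r)⁻¹β₂c_r·e^{−(δ−2σ)d}`. [cite: Balaban1984PropagatorsII, (2.133) p.247 («y, y′ ∈ 𝔅 ∩ T_□»: shape); Balaban1985BackgroundPropagators, (3.42) p.397] -/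
theorem hasMaj_projO_dressedV_comp_adj_loc₂ (htri : Triangle254 g) (hd : ∀ a b : g.Site, 0 ≤ g.dist a b) (hd0 : ∀ y : g.Site, g.dist y y = 0) (hrow : RowSum g σ cr) (hσ : 0 ≤ σ)
    (hD : ∀ j, D j = Dq j ∘ₗ G₀) (hunit : IsUnit (1 - LinearMap.toMatrix' (stack G₀ D ∘ₗ V))) {S : Set g.Site} {χX ψX ψ₂X : X → ℝ} (hSχ : ∀ x, χX x ≠ 0 → blk x ∈ S)
    (hSψ₂ : ∀ x, ψ₂X x ≠ 0 → blk x ∈ S) (hGχ : mulOp (fun p : X × ι => χX p.1) ∘ₗ G₀ = G₀) (hGψ : G₀ ∘ₗ mulOp (fun p : X × ι => ψX p.1) = G₀) {β₂ θW δ : ℝ} (hβ₂ : 0 ≤ β₂)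
    (hθW : 0 ≤ θW) (hcr : 0 ≤ cr) (hσδ : 2 * σ ≤ δ) (Q : (X × ι → ℝ) →ₗ[ℝ] (X × ι → ℝ))
    (hQ : mulOp (fun p : X × ι => ψX p.1) ∘ₗ Q ∘ₗ mulOp (fun p : X × ι => ψ₂X p.1) = mulOp (fun p : X × ι => ψX p.1) ∘ₗ Q)
    (hW : HasMaj (BlockNorm.ofBlocks g (liftBlk blk ι)) (BlockNorm.ofBlocks g (liftBlk blk ι)) (G₀ ∘ₗ V ∘ₗ stack LinearMap.id Dq ∘ₗ mulOp (fun p : X × ι => χX p.1))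
      (fun y y' => θW * Real.exp (-(δ * g.dist y y'))))
    (hGQ : HasMaj (BlockNorm.ofBlocks g (liftBlk blk ι)) (BlockNorm.ofBlocks g (liftBlk blk ι)) (G₀ ∘ₗ Q) (fun y y' => β₂ * Real.exp (-(δ * g.dist y y')))) (hq : θW * cr < 1) :
    HasMaj (BlockNorm.ofBlocks g (liftBlk blk ι)) (BlockNorm.ofBlocks g (liftBlk blk ι)) ((projO none ∘ₗ bgPropV (stack G₀ D) V) ∘ₗ Q)
      (fun y y' => ind S y * ind S y' * ((1 - θW * cr)⁻¹ * β₂ * cr * Real.exp (-((δ - 2 * σ) * g.dist y y')))) := by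
  have key := hasMaj_projO_dressedV_comp_adj blk htri hd hd0 hrow hσ hD hunit hGχ hβ₂ hθW hσδ Q hW hGQ hq
  have hinv0 : 0 ≤ (1 - θW * cr)⁻¹ := inv_nonneg.2 (by linarith)
  have hχ : mulOp (fun p : X × ι => χX p.1) ∘ₗ (projO none ∘ₗ stack G₀ D) = projO none ∘ₗ stack G₀ D := by rw [projO_none_comp_stack]; exact hGχ
  obtain ⟨hout, hin⟩ := projO_dressedV_comp_cutoffs (V := V) hD hunit none hχ hGψ hQ
  refine hasMaj_localize (liftBlk blk ι) (liftBlk blk ι) (fun a b => mul_nonneg (mul_nonneg (mul_nonneg hinv0 hβ₂) hcr) (Real.exp_nonneg _)) (fun μ p hp => ?_) (fun μ hμ => ?_) key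
  · have hχ0 : χX p.1 = 0 := by by_contra h; exact hp (hSχ p.1 h)
    rw [← hout]
    simp only [LinearMap.comp_apply, mulOp_apply, hχ0, zero_mul]
  · rw [← hin, LinearMap.comp_apply, mulOp_eq_zero_of_vanish blk hSψ₂ μ hμ, map_zero]

/-- `Ñ_𝒲∘F` keeps `F`'s OUTPUT cut when `𝒲` has it: `M_χ𝒲 = 𝒲`, `M_χF = F` ⟹ `M_χ(Ñ_𝒲F) = Ñ_𝒲F` (`Ñ = 1 + 𝒲Ñ`). [folklore] -/
theorem mulOp_comp_neumannR_comp {W F : (X × ι → ℝ) →ₗ[ℝ] (X × ι → ℝ)} (hunitW : IsUnit (1 - LinearMap.toMatrix' W)) {χX : X → ℝ}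
    (hWχ : mulOp (fun p : X × ι => χX p.1) ∘ₗ W = W) (hFχ : mulOp (fun p : X × ι => χX p.1) ∘ₗ F = F) :
    mulOp (fun p : X × ι => χX p.1) ∘ₗ (neumannR W ∘ₗ F) = neumannR W ∘ₗ F := by
  have hN : neumannR W ∘ₗ F = F + W ∘ₗ (neumannR W ∘ₗ F) := by
    conv_lhs => rw [neumannR_fix hunitW]
    rw [LinearMap.add_comp, LinearMap.id_comp, LinearMap.comp_assoc]
  rw [hN, LinearMap.comp_add, hFχ]
  congr 1
  rw [← LinearMap.comp_assoc, hWχ]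

/-- ★ **THE RIGHT-LOCALITY DEFECT's ROW, TWO-SIDED** (FILE 147's `hEd` currency): `𝒲 ≤ θ_𝒲e^{−δd}` (`θ_𝒲c_r < 1`), `F ≤ ε_Fe^{−δd}`, the output cut `M_χ𝒲 = 𝒲`, `M_χF = F` (`supp χ` over `S`) and the
input cut `FM_{ψ₂} = F` (`supp ψ₂` over `S`) ⟹ `Ñ_𝒲∘F ≤ 1_S(y)1_S(y′)·(1 − θ_𝒲c_r)⁻¹ε_Fc_r·e^{−(δ−2σ)d}`. [cite: Balaban1984PropagatorsII, (2.133)–(2.135) p.247 (shapes); (2.52)–(2.56) pp.232–233 (mechanism)] -/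
theorem hasMaj_neumannR_comp_loc₂ (htri : Triangle254 g) (hd : ∀ a b : g.Site, 0 ≤ g.dist a b) (hd0 : ∀ y : g.Site, g.dist y y = 0) (hrow : RowSum g σ cr) (hσ : 0 ≤ σ) (hcr : 0 ≤ cr)
    {W F : (X × ι → ℝ) →ₗ[ℝ] (X × ι → ℝ)} {S : Set g.Site} {χX ψ₂X : X → ℝ} (hSχ : ∀ x, χX x ≠ 0 → blk x ∈ S) (hSψ₂ : ∀ x, ψ₂X x ≠ 0 → blk x ∈ S)
    (hWχ : mulOp (fun p : X × ι => χX p.1) ∘ₗ W = W) (hFχ : mulOp (fun p : X × ι => χX p.1) ∘ₗ F = F) (hFψ : F ∘ₗ mulOp (fun p : X × ι => ψ₂X p.1) = F) {εF θW δ : ℝ}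
    (hε : 0 ≤ εF) (hθW : 0 ≤ θW) (hσδ : 2 * σ ≤ δ)
    (hW : HasMaj (BlockNorm.ofBlocks g (liftBlk blk ι)) (BlockNorm.ofBlocks g (liftBlk blk ι)) W (fun y y' => θW * Real.exp (-(δ * g.dist y y'))))
    (hF : HasMaj (BlockNorm.ofBlocks g (liftBlk blk ι)) (BlockNorm.ofBlocks g (liftBlk blk ι)) F (fun y y' => εF * Real.exp (-(δ * g.dist y y')))) (hq : θW * cr < 1) :
    HasMaj (BlockNorm.ofBlocks g (liftBlk blk ι)) (BlockNorm.ofBlocks g (liftBlk blk ι)) (neumannR W ∘ₗ F)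
      (fun y y' => ind S y * ind S y' * ((1 - θW * cr)⁻¹ * εF * cr * Real.exp (-((δ - 2 * σ) * g.dist y y')))) := by
  have key := hasMaj_neumannR_comp (liftBlk blk ι) htri hd hd0 hrow hσ hε hθW hσδ hF hW hq
  have hunitW := isUnit_neumannR (liftBlk blk ι) hd hrow hθW (by linarith) hW hq
  have hout := mulOp_comp_neumannR_comp (F := F) hunitW hWχ hFχ
  have hinv0 : 0 ≤ (1 - θW * cr)⁻¹ := inv_nonneg.2 (by linarith)
  refine hasMaj_localize (liftBlk blk ι) (liftBlk blk ι) (fun a b => mul_nonneg (mul_nonneg (mul_nonneg hinv0 hε) hcr) (Real.exp_nonneg _)) (fun μ p hp => ?_) (fun μ hμ => ?_) key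
  · have hχ0 : χX p.1 = 0 := by by_contra h; exact hp (hSχ p.1 h)
    rw [← hout]
    simp only [LinearMap.comp_apply, mulOp_apply, hχ0, zero_mul]
  · rw [← hFψ, LinearMap.comp_apply, LinearMap.comp_apply, mulOp_eq_zero_of_vanish blk hSψ₂ μ hμ, map_zero, map_zero]

end Rows

/-! ## §3 Two grids: the η-defects of the adjoint-form right entries and of the right-locality defect -/

section TwoGrid

variable {X X' ι J : Type} [Fintype X] [Fintype X'] [DecidableEq X] [DecidableEq X'] [Fintype ι] [DecidableEq ι] [Fintype J] [DecidableEq J] {g : B6.Geometry}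
  (blk : X → g.Site) (π : X' → X) {σ cr : ℝ} {G₀ : (X × ι → ℝ) →ₗ[ℝ] (X × ι → ℝ)} {D Dq : J ⊕ J → (X × ι → ℝ) →ₗ[ℝ] (X × ι → ℝ)}
  {V : ((X × ι) × Option (J ⊕ J) → ℝ) →ₗ[ℝ] (X × ι → ℝ)} {G₀' : (X' × ι → ℝ) →ₗ[ℝ] (X' × ι → ℝ)} {D' Dq' : J ⊕ J → (X' × ι → ℝ) →ₗ[ℝ] (X' × ι → ℝ)}
  {V' : ((X' × ι) × Option (J ⊕ J) → ℝ) →ₗ[ℝ] (X' × ι → ℝ)}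

/-- ★★★ **THE η-DEFECT OF A RIGHT ENTRY IN THE ADJOINT FORM**: at both grids the data of ★★ `hasMaj_projO_dressedV_comp_adj` (`𝒲, 𝒲′ ≤ θ_𝒲e^{−δd}`, `θ_𝒲c_r < 1`, coarse `G₀∘Q ≤ Ae^{−δd}`), the
two-grid defects `𝔇(𝒲′, 𝒲) ≤ re^{−δd}`, `𝔇(G₀′∘Q′, G₀∘Q) ≤ me^{−δd}` ⟹ `𝔇(X′∘Q′, X∘Q) ≤ [(1−q)⁻¹mc_r + (1−q)⁻¹(r((1−q)⁻¹Ac_r)c_r)c_r]·e^{−(δ−2σ)d}`, `q = θ_𝒲c_r` (FILE 44 `hasMaj_idef_glueInvL_comp`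
— NO mixed row and NO mixed-row defect). [cite: Balaban1985BackgroundPropagators, Thm 3.14 pp.426–427 (difference template), (3.42) p.397 (entry `G∇*_U`); Balaban1984PropagatorsII, (2.52)–(2.56) pp.232–233, (2.136) p.247] -/
theorem hasMaj_idef_projO_dressedV_comp_adj (htri : Triangle254 g) (hd : ∀ a b : g.Site, 0 ≤ g.dist a b) (hd0 : ∀ y : g.Site, g.dist y y = 0) (hrow : RowSum g σ cr) (hσ : 0 ≤ σ)
    (hcr : 0 ≤ cr) (hD : ∀ j, D j = Dq j ∘ₗ G₀) (hD' : ∀ j, D' j = Dq' j ∘ₗ G₀') (hunit : IsUnit (1 - LinearMap.toMatrix' (stack G₀ D ∘ₗ V)))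
    (hunit' : IsUnit (1 - LinearMap.toMatrix' (stack G₀' D' ∘ₗ V'))) {χX : X → ℝ} {χX' : X' → ℝ} (hGχ : mulOp (fun p : X × ι => χX p.1) ∘ₗ G₀ = G₀)
    (hGχ' : mulOp (fun p : X' × ι => χX' p.1) ∘ₗ G₀' = G₀') {A θW m r δ : ℝ} (hA : 0 ≤ A) (hθW : 0 ≤ θW) (hm : 0 ≤ m) (hr : 0 ≤ r) (hσδ : 2 * σ ≤ δ)
    (Q : (X × ι → ℝ) →ₗ[ℝ] (X × ι → ℝ)) (Q' : (X' × ι → ℝ) →ₗ[ℝ] (X' × ι → ℝ))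
    (hW : HasMaj (BlockNorm.ofBlocks g (liftBlk blk ι)) (BlockNorm.ofBlocks g (liftBlk blk ι)) (G₀ ∘ₗ V ∘ₗ stack LinearMap.id Dq ∘ₗ mulOp (fun p : X × ι => χX p.1))
      (fun y y' => θW * Real.exp (-(δ * g.dist y y'))))
    (hW' : HasMaj (BlockNorm.ofBlocks g (liftBlk (blk ∘ π) ι)) (BlockNorm.ofBlocks g (liftBlk (blk ∘ π) ι)) (G₀' ∘ₗ V' ∘ₗ stack LinearMap.id Dq' ∘ₗ mulOp (fun p : X' × ι => χX' p.1))
      (fun y y' => θW * Real.exp (-(δ * g.dist y y'))))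
    (hDW : HasMaj (BlockNorm.ofBlocks g (liftBlk blk ι)) (BlockNorm.ofBlocks g (liftBlk (blk ∘ π) ι))
      (idef (pull (liftMap π ι)) (pull (liftMap π ι)) (G₀' ∘ₗ V' ∘ₗ stack LinearMap.id Dq' ∘ₗ mulOp (fun p : X' × ι => χX' p.1)) (G₀ ∘ₗ V ∘ₗ stack LinearMap.id Dq ∘ₗ mulOp (fun p : X × ι => χX p.1)))
      (fun y y' => r * Real.exp (-(δ * g.dist y y'))))
    (hGQ : HasMaj (BlockNorm.ofBlocks g (liftBlk blk ι)) (BlockNorm.ofBlocks g (liftBlk blk ι)) (G₀ ∘ₗ Q) (fun y y' => A * Real.exp (-(δ * g.dist y y'))))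
    (hDGQ : HasMaj (BlockNorm.ofBlocks g (liftBlk blk ι)) (BlockNorm.ofBlocks g (liftBlk (blk ∘ π) ι)) (idef (pull (liftMap π ι)) (pull (liftMap π ι)) (G₀' ∘ₗ Q') (G₀ ∘ₗ Q))
      (fun y y' => m * Real.exp (-(δ * g.dist y y')))) (hq : θW * cr < 1) :
    HasMaj (BlockNorm.ofBlocks g (liftBlk blk ι)) (BlockNorm.ofBlocks g (liftBlk (blk ∘ π) ι))
      (idef (pull (liftMap π ι)) (pull (liftMap π ι)) ((projO none ∘ₗ bgPropV (stack G₀' D') V') ∘ₗ Q') ((projO none ∘ₗ bgPropV (stack G₀ D) V) ∘ₗ Q))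
      (fun y y' => ((1 - θW * cr)⁻¹ * m * cr + (1 - θW * cr)⁻¹ * (r * ((1 - θW * cr)⁻¹ * A * cr) * cr) * cr) * Real.exp (-((δ - 2 * σ) * g.dist y y'))) := by
  have hunitW := isUnit_neumannR (liftBlk blk ι) hd hrow hθW (by linarith) hW hq
  have hunitW' := isUnit_neumannR (liftBlk (blk ∘ π) ι) hd hrow hθW (by linarith) hW' hq
  rw [projO_dressedV_comp_eq hD hunit hGχ hunitW Q, projO_dressedV_comp_eq hD' hunit' hGχ' hunitW' Q']
  exact hasMaj_idef_glueInvL_comp (liftBlk blk ι) (liftMap π ι) htri hd hd0 hrow hσ hcr hA hθW hm hr hσδ hGQ hW hW' hDGQ hDW hq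

/-- ★★ **… TWO-SIDED LOCALIZED** by the cut-offs `χ`, `ψ ⊂ ψ₂` at both grids (file 29 `hasMaj_idef_projO_dressedV_comp_loc₂_of`) — FILE 147's `hIGE` currency.
[cite: Balaban1984PropagatorsII, (2.133) p.247 (shape); Balaban1985BackgroundPropagators, Thm 3.14 pp.426–427 (template)] -/
theorem hasMaj_idef_projO_dressedV_comp_adj_loc₂ (htri : Triangle254 g) (hd : ∀ a b : g.Site, 0 ≤ g.dist a b) (hd0 : ∀ y : g.Site, g.dist y y = 0) (hrow : RowSum g σ cr) (hσ : 0 ≤ σ)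
    (hcr : 0 ≤ cr) (hD : ∀ j, D j = Dq j ∘ₗ G₀) (hD' : ∀ j, D' j = Dq' j ∘ₗ G₀') (hunit : IsUnit (1 - LinearMap.toMatrix' (stack G₀ D ∘ₗ V)))
    (hunit' : IsUnit (1 - LinearMap.toMatrix' (stack G₀' D' ∘ₗ V'))) {S : Set g.Site} {χX ψX ψ₂X : X → ℝ} {χX' ψX' ψ₂X' : X' → ℝ} (hSχ : ∀ x, χX x ≠ 0 → blk x ∈ S)
    (hSψ₂ : ∀ x, ψ₂X x ≠ 0 → blk x ∈ S) (hSχ' : ∀ x', χX' x' ≠ 0 → blk (π x') ∈ S) (hSψ₂' : ∀ x', ψ₂X' x' ≠ 0 → blk (π x') ∈ S)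
    (hGχ : mulOp (fun p : X × ι => χX p.1) ∘ₗ G₀ = G₀) (hGψ : G₀ ∘ₗ mulOp (fun p : X × ι => ψX p.1) = G₀) (hGχ' : mulOp (fun p : X' × ι => χX' p.1) ∘ₗ G₀' = G₀')
    (hGψ' : G₀' ∘ₗ mulOp (fun p : X' × ι => ψX' p.1) = G₀') {A θW m r δ : ℝ} (hA : 0 ≤ A) (hθW : 0 ≤ θW) (hm : 0 ≤ m) (hr : 0 ≤ r) (hσδ : 2 * σ ≤ δ)
    (Q : (X × ι → ℝ) →ₗ[ℝ] (X × ι → ℝ)) (Q' : (X' × ι → ℝ) →ₗ[ℝ] (X' × ι → ℝ))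
    (hQ : mulOp (fun p : X × ι => ψX p.1) ∘ₗ Q ∘ₗ mulOp (fun p : X × ι => ψ₂X p.1) = mulOp (fun p : X × ι => ψX p.1) ∘ₗ Q)
    (hQ' : mulOp (fun p : X' × ι => ψX' p.1) ∘ₗ Q' ∘ₗ mulOp (fun p : X' × ι => ψ₂X' p.1) = mulOp (fun p : X' × ι => ψX' p.1) ∘ₗ Q')
    (hW : HasMaj (BlockNorm.ofBlocks g (liftBlk blk ι)) (BlockNorm.ofBlocks g (liftBlk blk ι)) (G₀ ∘ₗ V ∘ₗ stack LinearMap.id Dq ∘ₗ mulOp (fun p : X × ι => χX p.1))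
      (fun y y' => θW * Real.exp (-(δ * g.dist y y'))))
    (hW' : HasMaj (BlockNorm.ofBlocks g (liftBlk (blk ∘ π) ι)) (BlockNorm.ofBlocks g (liftBlk (blk ∘ π) ι)) (G₀' ∘ₗ V' ∘ₗ stack LinearMap.id Dq' ∘ₗ mulOp (fun p : X' × ι => χX' p.1))
      (fun y y' => θW * Real.exp (-(δ * g.dist y y'))))
    (hDW : HasMaj (BlockNorm.ofBlocks g (liftBlk blk ι)) (BlockNorm.ofBlocks g (liftBlk (blk ∘ π) ι))
      (idef (pull (liftMap π ι)) (pull (liftMap π ι)) (G₀' ∘ₗ V' ∘ₗ stack LinearMap.id Dq' ∘ₗ mulOp (fun p : X' × ι => χX' p.1)) (G₀ ∘ₗ V ∘ₗ stack LinearMap.id Dq ∘ₗ mulOp (fun p : X × ι => χX p.1)))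
      (fun y y' => r * Real.exp (-(δ * g.dist y y'))))
    (hGQ : HasMaj (BlockNorm.ofBlocks g (liftBlk blk ι)) (BlockNorm.ofBlocks g (liftBlk blk ι)) (G₀ ∘ₗ Q) (fun y y' => A * Real.exp (-(δ * g.dist y y'))))
    (hDGQ : HasMaj (BlockNorm.ofBlocks g (liftBlk blk ι)) (BlockNorm.ofBlocks g (liftBlk (blk ∘ π) ι)) (idef (pull (liftMap π ι)) (pull (liftMap π ι)) (G₀' ∘ₗ Q') (G₀ ∘ₗ Q))
      (fun y y' => m * Real.exp (-(δ * g.dist y y')))) (hq : θW * cr < 1) :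
    HasMaj (BlockNorm.ofBlocks g (liftBlk blk ι)) (BlockNorm.ofBlocks g (liftBlk (blk ∘ π) ι))
      (idef (pull (liftMap π ι)) (pull (liftMap π ι)) ((projO none ∘ₗ bgPropV (stack G₀' D') V') ∘ₗ Q') ((projO none ∘ₗ bgPropV (stack G₀ D) V) ∘ₗ Q))
      (fun y y' => ind S y * ind S y' *
        (((1 - θW * cr)⁻¹ * m * cr + (1 - θW * cr)⁻¹ * (r * ((1 - θW * cr)⁻¹ * A * cr) * cr) * cr) * Real.exp (-((δ - 2 * σ) * g.dist y y')))) := by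
  have key := hasMaj_idef_projO_dressedV_comp_adj blk π htri hd hd0 hrow hσ hcr hD hD' hunit hunit' hGχ hGχ' hA hθW hm hr hσδ Q Q' hW hW' hDW hGQ hDGQ hq
  have hinv0 : 0 ≤ (1 - θW * cr)⁻¹ := inv_nonneg.2 (by linarith)
  have hχ : mulOp (fun p : X × ι => χX p.1) ∘ₗ (projO none ∘ₗ stack G₀ D) = projO none ∘ₗ stack G₀ D := by rw [projO_none_comp_stack]; exact hGχ
  have hχ' : mulOp (fun p : X' × ι => χX' p.1) ∘ₗ (projO none ∘ₗ stack G₀' D') = projO none ∘ₗ stack G₀' D' := by rw [projO_none_comp_stack]; exact hGχ'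
  exact hasMaj_idef_projO_dressedV_comp_loc₂_of blk π hD hD' hunit hunit' none hSχ hSψ₂ hSχ' hSψ₂' hχ hGψ hQ hχ' hGψ' hQ' (fun a b => by positivity) key

/-- ★★ **THE η-DEFECT OF THE RIGHT-LOCALITY DEFECT `Ñ_𝒲∘F`, TWO-SIDED** (FILE 147's `hDEd` currency): `𝒲, 𝒲′` rows and defect as above, coarse `F ≤ ε_Fe^{−δd}`, `𝔇(F′, F) ≤ r_Fe^{−δd}`, the
cut-offs of `𝒲`, `F` at both grids ⟹ `𝔇(Ñ′F′, ÑF) ≤ 1_S1_S·[(1−q)⁻¹r_Fc_r + (1−q)⁻¹(r((1−q)⁻¹ε_Fc_r)c_r)c_r]·e^{−(δ−2σ)d}`. [cite: Balaban1985BackgroundPropagators, Thm 3.14 pp.426–427 (template); Balaban1984PropagatorsII, (2.135)–(2.136) p.247] -/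
theorem hasMaj_idef_neumannR_comp_loc₂ (htri : Triangle254 g) (hd : ∀ a b : g.Site, 0 ≤ g.dist a b) (hd0 : ∀ y : g.Site, g.dist y y = 0) (hrow : RowSum g σ cr) (hσ : 0 ≤ σ) (hcr : 0 ≤ cr)
    {W F : (X × ι → ℝ) →ₗ[ℝ] (X × ι → ℝ)} {W' F' : (X' × ι → ℝ) →ₗ[ℝ] (X' × ι → ℝ)} {S : Set g.Site} {χX ψ₂X : X → ℝ} {χX' ψ₂X' : X' → ℝ}
    (hSχ : ∀ x, χX x ≠ 0 → blk x ∈ S) (hSψ₂ : ∀ x, ψ₂X x ≠ 0 → blk x ∈ S) (hSχ' : ∀ x', χX' x' ≠ 0 → blk (π x') ∈ S) (hSψ₂' : ∀ x', ψ₂X' x' ≠ 0 → blk (π x') ∈ S)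
    (hWχ : mulOp (fun p : X × ι => χX p.1) ∘ₗ W = W) (hFχ : mulOp (fun p : X × ι => χX p.1) ∘ₗ F = F) (hFψ : F ∘ₗ mulOp (fun p : X × ι => ψ₂X p.1) = F)
    (hWχ' : mulOp (fun p : X' × ι => χX' p.1) ∘ₗ W' = W') (hFχ' : mulOp (fun p : X' × ι => χX' p.1) ∘ₗ F' = F') (hFψ' : F' ∘ₗ mulOp (fun p : X' × ι => ψ₂X' p.1) = F')
    {εF θW rF r δ : ℝ} (hε : 0 ≤ εF) (hθW : 0 ≤ θW) (hrF : 0 ≤ rF) (hr : 0 ≤ r) (hσδ : 2 * σ ≤ δ)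
    (hW : HasMaj (BlockNorm.ofBlocks g (liftBlk blk ι)) (BlockNorm.ofBlocks g (liftBlk blk ι)) W (fun y y' => θW * Real.exp (-(δ * g.dist y y'))))
    (hW' : HasMaj (BlockNorm.ofBlocks g (liftBlk (blk ∘ π) ι)) (BlockNorm.ofBlocks g (liftBlk (blk ∘ π) ι)) W' (fun y y' => θW * Real.exp (-(δ * g.dist y y'))))
    (hDW : HasMaj (BlockNorm.ofBlocks g (liftBlk blk ι)) (BlockNorm.ofBlocks g (liftBlk (blk ∘ π) ι)) (idef (pull (liftMap π ι)) (pull (liftMap π ι)) W' W)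
      (fun y y' => r * Real.exp (-(δ * g.dist y y'))))
    (hF : HasMaj (BlockNorm.ofBlocks g (liftBlk blk ι)) (BlockNorm.ofBlocks g (liftBlk blk ι)) F (fun y y' => εF * Real.exp (-(δ * g.dist y y'))))
    (hDF : HasMaj (BlockNorm.ofBlocks g (liftBlk blk ι)) (BlockNorm.ofBlocks g (liftBlk (blk ∘ π) ι)) (idef (pull (liftMap π ι)) (pull (liftMap π ι)) F' F)
      (fun y y' => rF * Real.exp (-(δ * g.dist y y')))) (hq : θW * cr < 1) :
    HasMaj (BlockNorm.ofBlocks g (liftBlk blk ι)) (BlockNorm.ofBlocks g (liftBlk (blk ∘ π) ι)) (idef (pull (liftMap π ι)) (pull (liftMap π ι)) (neumannR W' ∘ₗ F') (neumannR W ∘ₗ F))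
      (fun y y' => ind S y * ind S y' *
        (((1 - θW * cr)⁻¹ * rF * cr + (1 - θW * cr)⁻¹ * (r * ((1 - θW * cr)⁻¹ * εF * cr) * cr) * cr) * Real.exp (-((δ - 2 * σ) * g.dist y y')))) := by
  have key := hasMaj_idef_glueInvL_comp (liftBlk blk ι) (liftMap π ι) htri hd hd0 hrow hσ hcr hε hθW hrF hr hσδ hF hW hW' hDF hDW hq
  have hunitW := isUnit_neumannR (liftBlk blk ι) hd hrow hθW (by linarith) hW hq
  have hunitW' := isUnit_neumannR (liftBlk (blk ∘ π) ι) hd hrow hθW (by linarith) hW' hq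
  have houtc := mulOp_comp_neumannR_comp (F := F) hunitW hWχ hFχ
  have houtf := mulOp_comp_neumannR_comp (F := F') hunitW' hWχ' hFχ'
  have hinc : (neumannR W ∘ₗ F) ∘ₗ mulOp (fun p : X × ι => ψ₂X p.1) = neumannR W ∘ₗ F := by rw [LinearMap.comp_assoc, hFψ]
  have hinf : (neumannR W' ∘ₗ F') ∘ₗ mulOp (fun p : X' × ι => ψ₂X' p.1) = neumannR W' ∘ₗ F' := by rw [LinearMap.comp_assoc, hFψ']
  have hinv0 : 0 ≤ (1 - θW * cr)⁻¹ := inv_nonneg.2 (by linarith)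
  obtain ⟨hout, hin⟩ := idef_out_in blk π hSχ hSψ₂ hSχ' hSψ₂' houtc hinc houtf hinf
  exact hasMaj_localize (liftBlk blk ι) (liftBlk (blk ∘ π) ι) (fun a b => by positivity) hout hin key

end TwoGrid

end Summit.QuantumFields.YangMills.BalabanUVNodes.N15.Gluing

end
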